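import Summits.BirchSwinnertonDyer.Rank1Residual.X11b.KolyvaginShaOrderAtPrimeOfGross1991
import Summits.BirchSwinnertonDyer.Rank1Residual.X11b.KolyvaginShaAtPrimeOfGross1991
import Summits.BirchSwinnertonDyer.Rank1Residual.Additive.X4RankZeroLowerKolyvaginIndexForm
import Literature.NumberTheory.EllipticCurves.HeegnerPointsKolyvaginTorsionProofs
import HarnessLib

/-!
# McCallum 1991 §1 Theorem (Kolyvagin) in the printed Heegner-INDEX form at ONE odd surjective prime
# `p` — `ord_p #Ш(E/K)[p^∞] ≤ 2 · ord_p [E(K) : ℤ y_K]` — WITHOUT the Kodaira–Néron sub-class (KN_p),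
# modulo TWO NAMED facts (Gross 1991 Prop. 3.7 (2) and §6 / [GZ86, III (3.1)] BY NAME) and the
# Cassels–Tate inputs

Cell `b2b-bsdres`, team x11b3 (N8/O2 = X11b @ 3); seat x11b3-p2 GEN 54 (unit claimed D-0075 →
BSD:K2/P4 «Kolyvagin-in-kernel»; ladder-P4 ORDER form, index currency, every odd prime).
Summit-side THEOREM-ONLY file (no definition, no named fact, no `sorry`); `K : Type`; a general odd
prime `p`.

HONEST FRAMING (cell `b2b-bsdres`, run/shared/lean/b2b/bsd-rank1-residual/, verbatim in every
file): the goal of the cell is to DELETE the COMBINATION-SHAPED residual classes of the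
Birch–Swinnerton-Dyer formula for ALL analytic-rank `≤ 1` elliptic curves over `ℚ` — "full BSD
formula for every rank `≤ 1` curve in class `C`" assembled STRICTLY from published theorems — so
that the rank-`≤ 1` remainder becomes exactly the CONSTRUCTION-SHAPED classes, which are TYPED
(missing-input `Prop`s), NOT attempted.  This is not "finishing BSD".  Nothing here is booked; no
mark / label / count / tier moves; X11b @ `p` stays OPEN / CONSTRUCTION-SHAPED (Kolyvagin bounds
`Ш` relative to the Heegner index; it is ONE inequality of clause (iii), not `BSD_p`).

WHAT THIS FILE DOES.  The tree's generic-prime ORDER forms (`X11b/KolyvaginShaOrderAtPrime*`; this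
GEN's (KN_p)-free `KolyvaginDischarged.card_sha_primary_le_at_of_gross1991E0_of_localDuality_of_prop37`)
are stated in the `M₀`-currency `p^{M₀} x₀ = y_K ∉ p^{M₀+1} E(K)`, `M₀ ≥ 1`; the printed
Heegner-INDEX currency `M₀ = ord_p [E(K) : ℤ y_K]` (McCallum Lemma 5.1) existed in the tree only at
`p = 3` (`Three/KolyvaginShaOrderThree*`, on (KN₃)).  THIS FILE gives the INDEX form at EVERY odd
surjective prime, WITHOUT (KN_p): McCallum's Lemma 5.1 step (tree `Additive.zsmul_certificate_of_padicValNat_index`,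
with `E(K)[p] = 0` from `ρ̄_{E,p}` onto, `torsionBy_eq_bot_of_isImaginaryQuadratic`) converts the
index into `p^{M₀} x₀ = y_K ∉ p^{M₀+1} E(K)`; the case `M₀ ≥ 1` is this GEN's `M₀`-form, the case
`M₀ = 0` (`p ∤ y_K`) is `Ш(E/K)[p^∞] = 0` by this GEN's (KN_p)-free annihilator
`pow_smul_sha_primary_eq_zero_at_of_gross1991E0_of_prop37` at `m = 0` (Gross 1991 Prop. 2.1 (2)).  Net
(honest): for `E/ℚ` globally minimal without CM at `N = N_E`, `K` imaginary quadratic Heegner with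
`d_K ∉ {−3, −4}`, a non-torsion Heegner point `y_K` of FINITE index, `p` odd with `ρ̄_{E,p}` onto and
NO condition on Tamagawa numbers / Kodaira types: `Ш(E/K)[p^∞]` is finite, killed by
`p^{ord_p [E(K):ℤ y_K]}`, of order `≤ p^{2 ord_p [E(K):ℤ y_K]}`, i.e.
`ord_p #Ш(E/K)[p^∞] ≤ 2 · ord_p [E(K) : ℤ y_K]` — the printed shape of the named fact
`Kolyvagin1990_padicValNat_card_sha_le` (McCallum §1 Theorem) for the `p`-primary part — CONDITIONAL
on the TWO NAMED PUBLISHED facts {`GrossLMS1991.prop37_2_reductionCongruence N W K p`,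
`Gross1991_heegnerPoint_sub_ratTorsion_mem_E0`} + the displayed Cassels–Tate inputs; that named
fact itself is neither used nor discharged; neither input fact is discharged; nothing booked.

## What is proved

* `KolyvaginDischarged.card_sha_primary_le_at_of_gross1991E0_index_of_localDuality_of_prop37`.

## References

* [McCallumLMS1991] W. G. McCallum, LMS LNS 153 (1991), §1 Theorem (Kolyvagin), Lemma 5.1 (p. 303),
  Thm. 5.4, Cor. 5.6.  [GrossLMS1991] §2 Prop. 2.1 (2), Thm. 2.2 (2), §3 Prop. 3.7 (2) (p. 240),
  §6 Prop. 6.2 (1) and its proof (p. 245).  [GrossZagier1986Heegner] III (3.1) (p. 256).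
* [MilneADT2006] Ch. I §6, Thm. 6.13 (a).  [Mazur1977] III §5 (rational `p`-torsion vs. irreducibility).

presearch: `rg "^theorem .*index" X11b/KolyvaginShaOrder*AtPrime* X11b/KolyvaginShaOrderOfLeafInputs*`
→ no generic-prime INDEX form in the tree (only `Three/KolyvaginShaOrderThree*` at `p = 3`); parents
= this GEN's (KN_p)-free ENDs + the tree lemmas named above; [corpus: book:editornd-l-functions-arithmetic
p0281 (McCallum Lemma 5.1), p0222:L1, p0217:L19–L22]; nothing minted.
-/

noncomputable section

namespace Summit.BirchSwinnertonDyer.Rank1Residual.X11b.KolyvaginDischarged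

open scoped Classical
open WeierstrassCurve Field NumberField IsDedekindDomain Function
open Literature.NumberTheory.EllipticCurves Literature.NumberTheory.GaloisRepresentations
open Literature.NumberTheory.EllipticCurves.RingClassField
open Literature.NumberTheory.EllipticCurves.ModularForms
open Literature.NumberTheory.DiophantineGeometry Literature.NumberTheory.DiophantineGeometry.TateAlgorithm
open Literature.NumberTheory.GaloisCohomology
open Literature.NumberTheory.GaloisRepresentations.DiscreteGaloisModule (mu MuCarrier)
open Literature.NumberTheory.EllipticCurves.GrossLMS1991 (prop37_2_reductionCongruence)

-- `LocallyCompactSpace Γ_K` / `CharZero` of completions, as in the tree's Cassels–Tate files.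
attribute [local instance] absoluteGaloisGroup_compactSpace charZero_placeCompletion

variable {K : Type} [Field K] [NumberField K] {N : ℕ} {W : WeierstrassCurve ℚ}

/-- **McCallum 1991 §1 Theorem (Kolyvagin) at ONE odd surjective prime `p`, in the printed
Heegner-INDEX form: `ord_p #Ш(E/K)[p^∞] ≤ 2 · ord_p [E(K) : ℤ y_K]`** (for `[E(K) : ℤ y_K]` finite,
`_hidx`; the index is Mathlib's `AddSubgroup.index`), together with: `Ш(E/K)[p^∞]` finite, killed by
`p^{M₀}`, of order `≤ p^{2M₀}`, `M₀ = ord_p [E(K) : ℤ y_K]` — NO Kodaira–Néron hypothesis — modulo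
the TWO NAMED facts `GrossLMS1991.prop37_2_reductionCongruence N W K p` and
`Gross1991_heegnerPoint_sub_ratTorsion_mem_E0` and the displayed Cassels–Tate inputs.  McCallum's
Lemma 5.1 (`M₀ = max{M : y_K ∈ p^M E(K)}`, tree `Additive.zsmul_certificate_of_padicValNat_index`, using
`E(K)[p] = 0` from `ρ̄_{E,p}` onto, `torsionBy_eq_bot_of_isImaginaryQuadratic`) converts the index
into `p^{M₀} x₀ = y_K ∉ p^{M₀+1}E(K)`; `M₀ ≥ 1` is
`card_sha_primary_le_at_of_gross1991E0_of_localDuality_of_prop37`, `M₀ = 0` is `Ш(E/K)[p^∞] = 0`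
(Gross Prop. 2.1 (2): `pow_smul_sha_primary_eq_zero_at_of_gross1991E0_of_prop37` at `m = 0`).  Binders
= those of the `M₀`-form with `_hM₀`, `_hx₀`, `_hmax` REPLACED by `_hidx`, `_hv`; conclusion
VERBATIM.  For `E = W/ℚ` globally minimal, `¬ CM`, `N = N_E`, `K` imaginary quadratic Heegner with
`d_K ∉ {−3, −4}`, `P` a non-torsion Heegner point, `p` odd with `ρ̄_{E,p}` onto.  CONDITIONAL on
EXACTLY the two named facts (PUBLISHED, NOT discharged) + `hN` + the Cassels–Tate inputs; the named
fact `Kolyvagin1990_padicValNat_card_sha_le` is neither used nor discharged; nothing booked; no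
mark / count / tier moves. [cite: McCallumLMS1991, §1 Theorem (Kolyvagin), Lemma 5.1 (p. 303), Cor. 5.6]
[cite: GrossLMS1991, §2 Prop. 2.1 (2), Thm. 2.2 (2), §3 Prop. 3.7 (2), §6 Prop. 6.2 (1)]
[cite: GrossZagier1986Heegner, III (3.1) Proposition, p. 256] [cite: MilneADT2006, Ch. I §6, Thm. 6.13(a)] -/
theorem card_sha_primary_le_at_of_gross1991E0_index_of_localDuality_of_prop37 [NeZero N]
    [W.IsGloballyMinimal] {p : ℕ} (hp : p.Prime) (hp2 : p ≠ 2)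
    (hN : ∀ [W.IsElliptic], N = W.conductorNorm ℤ)
    (hE0 : Gross1991_heegnerPoint_sub_ratTorsion_mem_E0)
    (hγ : prop37_2_reductionCongruence N W K p) :
    ∀ [W.IsElliptic] (_hE : ¬ W.HasCM) (_hK : IsImaginaryQuadratic K)
      (_hD : NumberField.discr K ≠ -3 ∧ NumberField.discr K ≠ -4)
      (_hH : SatisfiesHeegnerHypothesis N K)
      {P : (W.baseChange K).toAffine.Point} (_hP : IsHeegnerPoint N W K P)
      (_hnt : ¬ IsOfFinAddOrder P) (_hρ : W.HasSurjectiveModNGaloisRep p)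
      (_hidx : (AddSubgroup.zmultiples P).index ≠ 0)
      {M₀ : ℕ} (_hv : padicValNat p (AddSubgroup.zmultiples P).index = M₀) [NeZero (p ^ M₀)]
      {c : K ≃ₐ[ℚ] K} (_hc : c ≠ 1) (_hcc : c * c = 1)
      (e : geomTorsion (W.baseChange K) ((p ^ M₀ * p ^ M₀ : ℕ) : ℤ) →
        geomTorsion (W.baseChange K) ((p ^ M₀ * p ^ M₀ : ℕ) : ℤ) → AlgebraicClosure K)
      (hμ : ∀ S T, e S T ^ (p ^ M₀ * p ^ M₀) = 1)
      (hadd₁ : ∀ S₁ S₂ T, e (S₁ + S₂) T = e S₁ T * e S₂ T)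
      (hadd₂ : ∀ S T₁ T₂, e S (T₁ + T₂) = e S T₁ * e S T₂)
      (hgal : ∀ (σ : absoluteGaloisGroup K) (S T : geomTorsion (W.baseChange K) ((p ^ M₀ * p ^ M₀ : ℕ) : ℤ)),
        σ • e S T = e (σ • S) (σ • T))
      (halt : ∀ T, e T T = 1) (hnondeg : ∀ T, (∀ S, e S T = 1) → T = 0)
      (inv : LocalInvariants K (p ^ M₀ * p ^ M₀)) (hPT' : inv.SumInvLocalizationEqZero)
      (hinv : ∀ v : HeightOneSpectrum (𝓞 K), Injective (inv (Sum.inr v)))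
      (hH3 : ∀ x : galoisCohomology (mu K (p ^ M₀ * p ^ M₀)) 3,
        (∀ v : Place K, galoisCohomology.localization (mu K (p ^ M₀ * p ^ M₀)) v 3 x = 0) → x = 0)
      (hB : Literature.GroupTheory.FiniteAbelian.IsLevelPairing (p ^ M₀)
        (ctLevelPairing (W.baseChange K) (p ^ M₀) e hμ hadd₁ hadd₂ hgal inv halt hPT' hH3
          (localTerm_finite_support (W := W.baseChange K) (m := p ^ M₀) (e := e) (hμ := hμ)
            (hadd₁ := hadd₁) (hadd₂ := hadd₂) (hgal := hgal) halt inv)))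
      (hPτ : ∀ z ∈ selmerGroup (W.baseChange K) ((p ^ M₀ * p ^ M₀ : ℕ) : ℤ),
        ∀ t ∈ selmerGroup (W.baseChange K) ((p ^ M₀ * p ^ M₀ : ℕ) : ℤ),
        ctGeneralFun (W.baseChange K) (p ^ M₀) e hμ hadd₁ hadd₂ hgal inv
            (torsionH1ToH1 (W.baseChange K) _ (conjAct W c _ z))
            (torsionH1ToH1 (W.baseChange K) _ (conjAct W c _ t)) =
          ctGeneralFun (W.baseChange K) (p ^ M₀) e hμ hadd₁ hadd₂ hgal inv
            (torsionH1ToH1 (W.baseChange K) _ z) (torsionH1ToH1 (W.baseChange K) _ t)),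
      Finite (AddCommGroup.primaryComponent (W.baseChange K).sha p) ∧
      (∀ c ∈ AddCommGroup.primaryComponent (W.baseChange K).sha p, p ^ M₀ • c = 0) ∧
      Nat.card (AddCommGroup.primaryComponent (W.baseChange K).sha p) ≤ p ^ (2 * M₀) ∧
      padicValNat p (Nat.card (AddCommGroup.primaryComponent (W.baseChange K).sha p)) ≤ 2 * M₀ := by
  intro _ hE hK hD hH P hP hnt hρ hidx M₀ hv _ c hc hcc e hμ hadd₁ hadd₂ hgal halt hnondeg inv hPT' hinv
    hH3 hB hPτ
  haveI : (W.baseChange K).IsElliptic := inferInstanceAs (W.map (algebraMap ℚ K)).IsElliptic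
  -- `E(K)[p] = 0` (`ρ̄_{E,p}` onto)
  have hbot := torsionBy_eq_bot_of_isImaginaryQuadratic W K hK hp hp2 hρ
  have hA : ∀ a : (W.baseChange K).toAffine.Point, ((p : ℕ) : ℤ) • a = 0 → a = 0 := fun a ha ↦ by
    have : a ∈ AddSubgroup.torsionBy (W.baseChange K).toAffine.Point ((p : ℕ) : ℤ) := by
      rw [mem_torsionBy_iff]; exact ha
    rw [hbot] at this
    exact this
  -- McCallum Lemma 5.1: `ord_p [E(K) : ℤ y_K] = M₀ ⟺ p^{M₀} ∥ y_K`
  obtain ⟨⟨x₀, hx₀⟩, hmax'⟩ := Additive.zsmul_certificate_of_padicValNat_index hp hA hnt hidx hv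
  have hx₀' : p ^ M₀ • x₀ = P := by rw [← natCast_zsmul]; exact hx₀
  have hmax : ∀ Q : (W.baseChange K).toAffine.Point, p ^ (M₀ + 1) • Q ≠ P := fun Q hQ ↦
    hmax' ⟨Q, by rw [natCast_zsmul]; exact hQ⟩
  rcases Nat.eq_zero_or_pos M₀ with h0 | hpos
  · -- `p ∤ y_K`: `Ш(E/K)[p^∞] = 0` (Gross Prop. 2.1 (2))
    subst h0
    have hz : ∀ c ∈ AddCommGroup.primaryComponent (W.baseChange K).sha p, c = 0 := fun c' hc' ↦ by
      have h := pow_smul_sha_primary_eq_zero_at_of_gross1991E0_of_prop37 hp hp2 hN hE0 hγ hE hK hD hH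
        hP hnt hρ (m := 0) (fun Q ↦ by simpa using hmax Q) c' (AddCommGroup.mem_primaryComponent.mp hc')
      simpa using h
    haveI : Subsingleton (AddCommGroup.primaryComponent (W.baseChange K).sha p) :=
      ⟨fun a b ↦ Subtype.ext ((hz a.1 a.2).trans (hz b.1 b.2).symm)⟩
    have hcard : Nat.card (AddCommGroup.primaryComponent (W.baseChange K).sha p) = 1 :=
      Nat.card_eq_one_iff_unique.mpr ⟨inferInstance, ⟨0⟩⟩
    refine ⟨Finite.of_subsingleton, fun c hc ↦ ?_, by rw [hcard]; simp, by rw [hcard]; simp⟩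
    rw [hz c hc, smul_zero]
  · exact card_sha_primary_le_at_of_gross1991E0_of_localDuality_of_prop37 hp hp2 hN hE0 hγ hE hK hD
      hH hP hnt hρ hpos hc hcc hx₀' hmax e hμ hadd₁ hadd₂ hgal halt hnondeg inv hPT' hinv hH3 hB hPτ

end Summit.BirchSwinnertonDyer.Rank1Residual.X11b.KolyvaginDischarged

end
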